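import Mathlib.Combinatorics.SimpleGraph.Coloring.Vertex
import Mathlib.Analysis.SpecialFunctions.Pow.Real
import Mathlib.Tactic
import HarnessLib

/-!
# A 4-chromatic unit-distance graph with all coordinates in `ℚ(√2, √3)` (10 vertices, 17 edges)

Framing (verbatim for the cell): lottery ticket; floor = certified bounds/negative ranges.

Census by-product of the (U) seat pub-namedobj-udg-g3 (TABLE-U3 §4): the field atlas predicts `χ(ℚ(√2,√3)²) ≤ 4`
(cell Prop U2, 2-adic inert case: `[3] = [−5]` in `ℚ₂^×/(ℚ₂^×)²`, `[−1] ∉ ⟨[2],[3]⟩`).  This file supplies the matching LOWER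
bound as a kernel theorem: an explicit 10-vertex unit-distance graph `l10` with coordinates in `ℚ(√2,√3)` (we write `√6` as
`√2 * √3`) that is not 3-colourable.  The graph was extracted (4-vertex-critical subgraph, exhaustive search) from the
Voronov–Neopryatnaya–Dergachev set `M₂ = clip(M₁ + M₁, 1)`, `M₁ = {0} ∪ {φ₀^q φ₁^p}`, `φ₀ = e^{iπ/12}`, `φ₁ = (√6 + i√3)/3`
(Discrete Math. 345 (2022) 113106 = arXiv:2106.11824, §6 series 2), whose 865 points all lie in `ℚ(√2,√3)²`; it has the
Laman count `17 = 2·10 − 3` of their minimally rigid 4-critical seed `L₁₀,₂`.  Coordinates and edges were verified by two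
independent exact engines of the cell before being typed here; here the kernel re-verifies everything (17 exact identities
in `ℚ(√2,√3)`, injectivity, non-3-colourability over `3¹⁰` assignments, an explicit 4-colouring).  Nothing is cited as literature.
-/

namespace Summit.Ventures.DiscreteObjects.UnitDistance.VNDL10

open Real

/-- The 17 edges on vertex set `Fin 10` (vertex `9` is the origin). -/
def edges : List (Fin 10 × Fin 10) :=
  [(0,1), (0,7), (0,8), (1,3), (1,6), (1,8), (2,3), (2,4), (2,5), (3,5), (3,9), (4,5), (4,6), (4,7), (6,9), (7,8), (7,9)]

/-- The graph `l10`: `i ~ j` iff `(i,j)` or `(j,i)` is a listed edge. -/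
def l10 : SimpleGraph (Fin 10) :=
  SimpleGraph.fromRel fun i j => (i, j) ∈ edges

/-- Adjacency in `l10` is decidable. -/
instance : DecidableRel l10.Adj := fun i j => by
  unfold l10; infer_instance

/-- Exact coordinates in `ℚ(√2,√3)` (`√6` written as `√2 * √3`); denominators divide 12. -/
noncomputable def pt : Fin 10 → ℝ × ℝ
  | 0 => ((-1/2 : ℝ) + (1/4 : ℝ)*√2 + (-1/3 : ℝ)*√3 + (1/12 : ℝ)*√2*√3, (-1/4 : ℝ)*√2 + (-1/6 : ℝ)*√3 + (1/12 : ℝ)*√2*√3)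
  | 1 => ((-1/2 : ℝ) + (1/4 : ℝ)*√2 + (1/4 : ℝ)*√2*√3, (-1/4 : ℝ)*√2 + (-1/2 : ℝ)*√3 + (1/4 : ℝ)*√2*√3)
  | 2 => ((-1/2 : ℝ) + (-1/3 : ℝ)*√3 + (1/6 : ℝ)*√2*√3, (-1/6 : ℝ)*√3 + (1/6 : ℝ)*√2*√3)
  | 3 => ((-1/2 : ℝ), (-1/2 : ℝ)*√3)
  | 4 => ((1/4 : ℝ)*√2 + (-1/2 : ℝ)*√3 + (1/4 : ℝ)*√2*√3, (1/2 : ℝ) + (-1/4 : ℝ)*√2 + (1/4 : ℝ)*√2*√3)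
  | 5 => ((1/4 : ℝ)*√2 + (-1/6 : ℝ)*√3 + (1/12 : ℝ)*√2*√3, (1/2 : ℝ) + (-1/4 : ℝ)*√2 + (-1/3 : ℝ)*√3 + (1/12 : ℝ)*√2*√3)
  | 6 => ((1/4 : ℝ)*√2 + (1/4 : ℝ)*√2*√3, (-1/4 : ℝ)*√2 + (1/4 : ℝ)*√2*√3)
  | 7 => ((-1/2 : ℝ)*√3, (1/2 : ℝ))
  | 8 => ((-1/6 : ℝ)*√3 + (1/6 : ℝ)*√2*√3, (1/2 : ℝ) + (-1/3 : ℝ)*√3 + (1/6 : ℝ)*√2*√3)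
  | 9 => (0, 0)

/-- Squared Euclidean distance on `ℝ × ℝ`. -/
def sqDist (p q : ℝ × ℝ) : ℝ := (p.1 - q.1) ^ 2 + (p.2 - q.2) ^ 2

/-- `(√2)² = 2` (plumbing). -/
private lemma s2 : (√2 : ℝ) ^ 2 = 2 := Real.sq_sqrt (by norm_num)
/-- `(√3)² = 3` (plumbing). -/
private lemma s3 : (√3 : ℝ) ^ 2 = 3 := Real.sq_sqrt (by norm_num)

/-- Every listed edge has squared length exactly `1` (17 exact identities in `ℚ(√2,√3)`). -/
theorem edges_sqDist_eq_one : ∀ e ∈ edges, sqDist (pt e.1) (pt e.2) = 1 := by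
  simp only [edges, List.mem_cons, List.not_mem_nil, or_false]
  rintro e (rfl | rfl | rfl | rfl | rfl | rfl | rfl | rfl | rfl | rfl | rfl | rfl | rfl | rfl | rfl | rfl | rfl)
  all_goals (simp only [sqDist, pt]; ring_nf; try (simp only [s2, s3]; norm_num))

/-- Adjacent vertices of `l10` are at squared distance `1`: `l10` is a unit-distance graph under `pt`. -/
theorem adj_sqDist_eq_one {i j : Fin 10} (h : l10.Adj i j) : sqDist (pt i) (pt j) = 1 := by
  rcases h with ⟨-, hij | hji⟩
  · exact edges_sqDist_eq_one (i, j) hij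
  · have := edges_sqDist_eq_one (j, i) hji
    simp only [sqDist] at this ⊢
    linarith [this]

/-- Vertex `0` differs from every other vertex (exact comparison in `ℚ(√2,√3)`). -/
private theorem pt_ne_0 (j : Fin 10) (h1 : (pt 0).1 = (pt j).1) (h2 : (pt 0).2 = (pt j).2) : (0 : Fin 10) = j := by
  have h2p : (0:ℝ) < √2 := Real.sqrt_pos.mpr (by norm_num)
  have h3p : (0:ℝ) < √3 := Real.sqrt_pos.mpr (by norm_num)
  have h23 : √2 < √3 := Real.sqrt_lt_sqrt (by norm_num) (by norm_num)
  have hs2 := s2; have hs3 := s3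
  have h6 : (0:ℝ) < √2 * √3 := mul_pos h2p h3p
  fin_cases j <;> simp only [pt] at h1 h2 <;>
    first | rfl | (exfalso; nlinarith [h2p, h3p, h23, hs2, hs3, h6])

/-- Vertex `1` differs from every other vertex (exact comparison in `ℚ(√2,√3)`). -/
private theorem pt_ne_1 (j : Fin 10) (h1 : (pt 1).1 = (pt j).1) (h2 : (pt 1).2 = (pt j).2) : (1 : Fin 10) = j := by
  have h2p : (0:ℝ) < √2 := Real.sqrt_pos.mpr (by norm_num)
  have h3p : (0:ℝ) < √3 := Real.sqrt_pos.mpr (by norm_num)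
  have h23 : √2 < √3 := Real.sqrt_lt_sqrt (by norm_num) (by norm_num)
  have hs2 := s2; have hs3 := s3
  have h6 : (0:ℝ) < √2 * √3 := mul_pos h2p h3p
  fin_cases j <;> simp only [pt] at h1 h2 <;>
    first | rfl | (exfalso; nlinarith [h2p, h3p, h23, hs2, hs3, h6])

/-- Vertex `2` differs from every other vertex (exact comparison in `ℚ(√2,√3)`). -/
private theorem pt_ne_2 (j : Fin 10) (h1 : (pt 2).1 = (pt j).1) (h2 : (pt 2).2 = (pt j).2) : (2 : Fin 10) = j := by
  have h2p : (0:ℝ) < √2 := Real.sqrt_pos.mpr (by norm_num)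
  have h3p : (0:ℝ) < √3 := Real.sqrt_pos.mpr (by norm_num)
  have h23 : √2 < √3 := Real.sqrt_lt_sqrt (by norm_num) (by norm_num)
  have hs2 := s2; have hs3 := s3
  have h6 : (0:ℝ) < √2 * √3 := mul_pos h2p h3p
  fin_cases j <;> simp only [pt] at h1 h2 <;>
    first | rfl | (exfalso; nlinarith [h2p, h3p, h23, hs2, hs3, h6])

/-- Vertex `3` differs from every other vertex (exact comparison in `ℚ(√2,√3)`). -/
private theorem pt_ne_3 (j : Fin 10) (h1 : (pt 3).1 = (pt j).1) (h2 : (pt 3).2 = (pt j).2) : (3 : Fin 10) = j := by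
  have h2p : (0:ℝ) < √2 := Real.sqrt_pos.mpr (by norm_num)
  have h3p : (0:ℝ) < √3 := Real.sqrt_pos.mpr (by norm_num)
  have h23 : √2 < √3 := Real.sqrt_lt_sqrt (by norm_num) (by norm_num)
  have hs2 := s2; have hs3 := s3
  have h6 : (0:ℝ) < √2 * √3 := mul_pos h2p h3p
  fin_cases j <;> simp only [pt] at h1 h2 <;>
    first | rfl | (exfalso; nlinarith [h2p, h3p, h23, hs2, hs3, h6])

/-- Vertex `4` differs from every other vertex (exact comparison in `ℚ(√2,√3)`). -/
private theorem pt_ne_4 (j : Fin 10) (h1 : (pt 4).1 = (pt j).1) (h2 : (pt 4).2 = (pt j).2) : (4 : Fin 10) = j := by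
  have h2p : (0:ℝ) < √2 := Real.sqrt_pos.mpr (by norm_num)
  have h3p : (0:ℝ) < √3 := Real.sqrt_pos.mpr (by norm_num)
  have h23 : √2 < √3 := Real.sqrt_lt_sqrt (by norm_num) (by norm_num)
  have hs2 := s2; have hs3 := s3
  have h6 : (0:ℝ) < √2 * √3 := mul_pos h2p h3p
  fin_cases j <;> simp only [pt] at h1 h2 <;>
    first | rfl | (exfalso; nlinarith [h2p, h3p, h23, hs2, hs3, h6])

/-- Vertex `5` differs from every other vertex (exact comparison in `ℚ(√2,√3)`). -/
private theorem pt_ne_5 (j : Fin 10) (h1 : (pt 5).1 = (pt j).1) (h2 : (pt 5).2 = (pt j).2) : (5 : Fin 10) = j := by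
  have h2p : (0:ℝ) < √2 := Real.sqrt_pos.mpr (by norm_num)
  have h3p : (0:ℝ) < √3 := Real.sqrt_pos.mpr (by norm_num)
  have h23 : √2 < √3 := Real.sqrt_lt_sqrt (by norm_num) (by norm_num)
  have hs2 := s2; have hs3 := s3
  have h6 : (0:ℝ) < √2 * √3 := mul_pos h2p h3p
  fin_cases j <;> simp only [pt] at h1 h2 <;>
    first | rfl | (exfalso; nlinarith [h2p, h3p, h23, hs2, hs3, h6])

/-- Vertex `6` differs from every other vertex (exact comparison in `ℚ(√2,√3)`). -/
private theorem pt_ne_6 (j : Fin 10) (h1 : (pt 6).1 = (pt j).1) (h2 : (pt 6).2 = (pt j).2) : (6 : Fin 10) = j := by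
  have h2p : (0:ℝ) < √2 := Real.sqrt_pos.mpr (by norm_num)
  have h3p : (0:ℝ) < √3 := Real.sqrt_pos.mpr (by norm_num)
  have h23 : √2 < √3 := Real.sqrt_lt_sqrt (by norm_num) (by norm_num)
  have hs2 := s2; have hs3 := s3
  have h6 : (0:ℝ) < √2 * √3 := mul_pos h2p h3p
  fin_cases j <;> simp only [pt] at h1 h2 <;>
    first | rfl | (exfalso; nlinarith [h2p, h3p, h23, hs2, hs3, h6])

/-- Vertex `7` differs from every other vertex (exact comparison in `ℚ(√2,√3)`). -/
private theorem pt_ne_7 (j : Fin 10) (h1 : (pt 7).1 = (pt j).1) (h2 : (pt 7).2 = (pt j).2) : (7 : Fin 10) = j := by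
  have h2p : (0:ℝ) < √2 := Real.sqrt_pos.mpr (by norm_num)
  have h3p : (0:ℝ) < √3 := Real.sqrt_pos.mpr (by norm_num)
  have h23 : √2 < √3 := Real.sqrt_lt_sqrt (by norm_num) (by norm_num)
  have hs2 := s2; have hs3 := s3
  have h6 : (0:ℝ) < √2 * √3 := mul_pos h2p h3p
  fin_cases j <;> simp only [pt] at h1 h2 <;>
    first | rfl | (exfalso; nlinarith [h2p, h3p, h23, hs2, hs3, h6])

/-- Vertex `8` differs from every other vertex (exact comparison in `ℚ(√2,√3)`). -/
private theorem pt_ne_8 (j : Fin 10) (h1 : (pt 8).1 = (pt j).1) (h2 : (pt 8).2 = (pt j).2) : (8 : Fin 10) = j := by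
  have h2p : (0:ℝ) < √2 := Real.sqrt_pos.mpr (by norm_num)
  have h3p : (0:ℝ) < √3 := Real.sqrt_pos.mpr (by norm_num)
  have h23 : √2 < √3 := Real.sqrt_lt_sqrt (by norm_num) (by norm_num)
  have hs2 := s2; have hs3 := s3
  have h6 : (0:ℝ) < √2 * √3 := mul_pos h2p h3p
  fin_cases j <;> simp only [pt] at h1 h2 <;>
    first | rfl | (exfalso; nlinarith [h2p, h3p, h23, hs2, hs3, h6])

/-- Vertex `9` differs from every other vertex (exact comparison in `ℚ(√2,√3)`). -/
private theorem pt_ne_9 (j : Fin 10) (h1 : (pt 9).1 = (pt j).1) (h2 : (pt 9).2 = (pt j).2) : (9 : Fin 10) = j := by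
  have h2p : (0:ℝ) < √2 := Real.sqrt_pos.mpr (by norm_num)
  have h3p : (0:ℝ) < √3 := Real.sqrt_pos.mpr (by norm_num)
  have h23 : √2 < √3 := Real.sqrt_lt_sqrt (by norm_num) (by norm_num)
  have hs2 := s2; have hs3 := s3
  have h6 : (0:ℝ) < √2 * √3 := mul_pos h2p h3p
  fin_cases j <;> simp only [pt] at h1 h2 <;>
    first | rfl | (exfalso; nlinarith [h2p, h3p, h23, hs2, hs3, h6])

/-- The ten points are pairwise distinct. -/
theorem pt_injective : Function.Injective pt := by
  intro i j hij
  have h1 := congrArg Prod.fst hij; have h2 := congrArg Prod.snd hij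
  fin_cases i
  · exact pt_ne_0 j h1 h2
  · exact pt_ne_1 j h1 h2
  · exact pt_ne_2 j h1 h2
  · exact pt_ne_3 j h1 h2
  · exact pt_ne_4 j h1 h2
  · exact pt_ne_5 j h1 h2
  · exact pt_ne_6 j h1 h2
  · exact pt_ne_7 j h1 h2
  · exact pt_ne_8 j h1 h2
  · exact pt_ne_9 j h1 h2

/-- Finite core of the non-3-colourability, Moser-style: the two diamonds `{0,8 | 1,7}` and `{2,5 | 3,4}` force
`f 1 = f 7` and `f 3 = f 4` in any proper 3-colouring; then vertex `6` (adjacent to `1` and `4`) takes the third colour and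
the origin `9` (adjacent to `3`, `6`, `7`) has no colour left. -/
theorem exists_mono_edge_three (f : Fin 10 → Fin 3) : ∃ e ∈ edges, f e.1 = f e.2 := by
  by_contra h
  simp only [not_exists, not_and] at h
  have ne : ∀ a b : Fin 10, (a, b) ∈ edges → f a ≠ f b := fun a b hab => h (a, b) hab
  have h01 := ne 0 1 (by simp [edges]); have h07 := ne 0 7 (by simp [edges]); have h08 := ne 0 8 (by simp [edges])
  have h13 := ne 1 3 (by simp [edges]); have h16 := ne 1 6 (by simp [edges]); have h18 := ne 1 8 (by simp [edges])
  have h23 := ne 2 3 (by simp [edges]); have h24 := ne 2 4 (by simp [edges]); have h25 := ne 2 5 (by simp [edges])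
  have h35 := ne 3 5 (by simp [edges]); have h39 := ne 3 9 (by simp [edges]); have h45 := ne 4 5 (by simp [edges])
  have h46 := ne 4 6 (by simp [edges]); have h69 := ne 6 9 (by simp [edges]); have h78 := ne 7 8 (by simp [edges])
  have h79 := ne 7 9 (by simp [edges])
  -- pigeonhole facts in `Fin 3`
  have pig : ∀ x y u v : Fin 3, u ≠ v → x ≠ u → x ≠ v → y ≠ u → y ≠ v → x = y := by decide
  have full : ∀ x u v w : Fin 3, u ≠ v → u ≠ w → v ≠ w → x = u ∨ x = v ∨ x = w := by decide
  have e17 : f 1 = f 7 := pig (f 1) (f 7) (f 0) (f 8) h08 h01.symm h18 h07.symm h78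
  have e34 : f 3 = f 4 := pig (f 3) (f 4) (f 2) (f 5) h25 h23.symm h35 h24.symm h45
  have h36 : f 3 ≠ f 6 := by rw [e34]; exact h46
  have h91 : f 9 ≠ f 1 := by rw [e17]; exact h79.symm
  rcases full (f 9) (f 1) (f 3) (f 6) h13 h16 h36 with q | q | q
  · exact h91 q
  · exact h39.symm q
  · exact h69.symm q

/-- Listed edges are edges of `l10` (plumbing). -/
private theorem adj_of_mem_edges {e : Fin 10 × Fin 10} (he : e ∈ edges) : l10.Adj e.1 e.2 := by
  refine ⟨?_, Or.inl he⟩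
  revert he; revert e; decide

/-- **`l10` is not 3-colourable.** -/
theorem not_colorable_three : ¬ l10.Colorable 3 := by
  rintro ⟨C⟩
  obtain ⟨e, he, hmono⟩ := exists_mono_edge_three C
  exact C.valid (adj_of_mem_edges he) hmono

/-- An explicit proper 4-colouring of `l10`. -/
def fourColouring : Fin 10 → Fin 4
  | 0 => 0 | 1 => 1 | 2 => 0 | 3 => 2 | 4 => 1 | 5 => 3 | 6 => 0 | 7 => 2 | 8 => 3 | 9 => 1

/-- `l10` is 4-colourable, hence `χ(l10) = 4`. -/
theorem colorable_four : l10.Colorable 4 :=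
  ⟨SimpleGraph.Coloring.mk fourColouring (by
    intro v w h
    have hvw : (v, w) ∈ edges ∨ (w, v) ∈ edges := h.2
    revert hvw; revert v w; decide)⟩

/-- The chromatic number of `l10` is exactly `4`. -/
theorem chromaticNumber_eq_four : l10.chromaticNumber = 4 := by
  rw [show (4 : ℕ∞) = (3 : ℕ) + 1 by norm_num]
  exact SimpleGraph.chromaticNumber_eq_iff_colorable_not_colorable.mpr ⟨colorable_four, not_colorable_three⟩

end Summit.Ventures.DiscreteObjects.UnitDistance.VNDL10
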